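import Literature.AlgebraicGeometry.HodgeTheory.CrossProductsGenericDivisibility
import Literature.AlgebraicGeometry.Motives.ProjectiveSpaceComplexPointsGradedBasis
import Literature.AlgebraicGeometry.Motives.ProjectiveSpaceComplexPointsGenericVanishing
import Summits.HodgeConjecture.HodgeConjecture.Theorems.GenericDivisibilityHodgeClassesGenericallyDivisibleAboveDim

/-!
# Route GenericDivisibility — crux `HodgeClassesGenericallyDivisible` (C1, item stmt-HodgeConjecture-18466):
# C1 holds for EVERY integral class on `Y ⊗ ℙⁿ`, `n ≥ 1`, unconditionally and Hodge-blind

For `Y` smooth projective over `ℂ` of dimension `d` and `n ≥ 1`, EVERY class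
`z ∈ Hᵏ((Y ⊗ ℙⁿ)(ℂ); ℤ)` of degree `k > d` dies on the complex points of a non-empty Zariski open of
`Y ⊗ ℙⁿ`. By the integral Künneth theorem (`HodgeTheory/CrossProductsGenericDivisibility` with the
graded basis `1, x, …, xⁿ` of `H*(ℙⁿ_ℂ(ℂ); ℤ)`, `Motives/ProjectiveSpaceComplexPointsGradedBasis`)
`z = Σⱼ pr_Y^* aⱼ ⌣ pr_ℙ^* xʲ`; the coefficient `a₀ ∈ Hᵏ(Y(ℂ); ℤ)` of `1` dies generically on `Y`
(`k > dim Y`: Andreotti–Frankel, `stub_aboveDimGenericallyZero_sharp`), and EVERY class of positive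
degree on `ℙⁿ_ℂ(ℂ)` — in particular `xʲ`, `j ≥ 1` — dies off a hyperplane, whose complement is an
affine space (`Motives/ProjectiveSpaceComplexPointsGenericVanishing`); the product descent (`μ = 0`)
assembles these on a product open. For the crux: `X = Y ⊗ ℙⁿ` of dimension `2p = d + n`, `k = 2p > d`.

* `genericDivisibility_tensorProjectiveSpace_restrict_eq_zero` — the strong form (`z| = 0`) in every
  degree `k > dim Y`;
* `stub_hodgeClassesGenericallyDivisible_tensorProjectiveSpace` — the registered sub-goal of the item:
  its statement for `X = Y ⊗ ℙⁿ` (`n ≥ 1`, `Y` of dimension `2p - n`) with NO Hodge-type hypothesis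
  (`y = 0` serves every `m`).

So the `2p`-folds `Y ⊗ ℙⁿ` (`n ≥ 1`) form a sector on which C1 is settled for all integral classes —
while the Hodge conjecture on them in degree `2p` amounts to the Hodge conjecture for `Y` in the
degrees `2p - 2j`, `0 ≤ j ≤ n`, not known in general — and a constraint for refuters (no witness
against "C1 without the `(p,p)` hypothesis" lives on a product with a projective space). The case
`n = 1` is `…ProjectiveLine`. The crux itself (all `2p`-folds) is untouched (open problem).

References: A. Hatcher, *Algebraic Topology* (2002), Thm. 3.16, Thm. 3.19, §3.1 p. 201
[HatcherAT2002]; A. Andreotti, T. Frankel, Ann. of Math. 69 (1959), Thm. 1 [AndreottiFrankel1959];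
J.-P. Serre, GAGA (1956), §2 n°5 [SerreGAGA1956].
-/

set_option linter.dupNamespace false

noncomputable section

namespace Summit.HodgeConjecture.HodgeConjecture.Theorems

open CategoryTheory MonoidalCategory
open Literature.AlgebraicGeometry.Motives Literature.AlgebraicGeometry.HodgeTheory
  Literature.AlgebraicTopology.SingularHomology
open Summit.HodgeConjecture.HodgeConjecture.Theses.GenericDivisibility

/-- **Every integral class of degree `> dim Y` on `Y ⊗ ℙⁿ⁺¹` dies on a non-empty Zariski open.**
For `Y` smooth projective over `ℂ` of dimension `d`, every `n` and `k > d`, every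
`z ∈ Hᵏ((Y ⊗ ℙⁿ⁺¹)(ℂ); ℤ)` restricts to zero on the complex points of the complement of a proper
Zariski-closed subset: Künneth along `1, x, …, xⁿ⁺¹`, Andreotti–Frankel on `Y` for the coefficient
of `1`, the affine chart of `ℙⁿ⁺¹` for the positive powers, and the product descent.
[cite: HatcherAT2002, §3.2 Thm. 3.16 and Thm. 3.19] [cite: AndreottiFrankel1959, Thm. 1]
[cite: SerreGAGA1956, §2 n°5] -/
theorem genericDivisibility_tensorProjectiveSpace_restrict_eq_zero {d : ℕ} {Y : SchemeOver ℂ}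
    (hY : IsSmoothProjective d Y) (n : ℕ) {k : ℕ} (hk : d < k)
    (z : singularCohomology ℤ ℤ (ComplexPoints (Y ⊗ projectiveSpace (n + 1) ℂ)) k) :
    ∃ Z : Set (Y ⊗ projectiveSpace (n + 1) ℂ).left, IsClosed Z ∧ Z ≠ Set.univ ∧
      singularCohomology.map ℤ ℤ
        (⟨Subtype.val, continuous_subtype_val⟩ :
          C(complexPointsCompl (Y ⊗ projectiveSpace (n + 1) ℂ) Z,
            ComplexPoints (Y ⊗ projectiveSpace (n + 1) ℂ))) k z = 0 := by
  have hP : IsSmoothProjective (n + 1) (projectiveSpace (n + 1) ℂ) :=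
    isSmoothProjective_projectiveSpace_holds ℂ (n + 1)
  obtain ⟨e, he⟩ := ComplexPoints.projectiveSpace_exists_gradedBasis ℤ (n + 1)
  -- degree `0`: Andreotti–Frankel on `Y`; positive degrees: the powers die off a hyperplane
  have hyp : ∀ j : Fin (n + 1 + 1), LerayHirsch.evenDeg (n + 1 + 1) j ≤ k →
      (∃ T : Set (projectiveSpace (n + 1) ℂ).left, IsClosed T ∧ T ≠ Set.univ ∧
        restrictToCompl ℤ (projectiveSpace (n + 1) ℂ) (LerayHirsch.evenDeg (n + 1 + 1) j) T
          (e j) = 0) ∨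
      (∀ x : singularCohomology ℤ ℤ (ComplexPoints Y) (k - LerayHirsch.evenDeg (n + 1 + 1) j),
        ∃ S : Set Y.left, IsClosed S ∧ S ≠ Set.univ ∧
          ∃ y : singularCohomology ℤ ℤ (complexPointsCompl Y S)
            (k - LerayHirsch.evenDeg (n + 1 + 1) j),
            restrictToCompl ℤ Y (k - LerayHirsch.evenDeg (n + 1 + 1) j) S x = 0 • y) := by
    rintro ⟨j, hjlt⟩ _
    by_cases hj0 : j = 0
    · subst hj0
      refine Or.inr fun x ↦ ?_
      have hk' : d < k - LerayHirsch.evenDeg (n + 1 + 1) ⟨0, hjlt⟩ := by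
        change d < k - 2 * 0
        omega
      obtain ⟨S, hS, hSne, hx⟩ := stub_aboveDimGenericallyZero_sharp hY hk' x
      exact ⟨S, hS, hSne, 0, by rw [nsmul_zero]; exact hx⟩
    · refine Or.inl ?_
      have h2 : LerayHirsch.evenDeg (n + 1 + 1) ⟨j, hjlt⟩ ≠ 0 := by
        change 2 * j ≠ 0
        omega
      exact ComplexPoints.projectiveSpace_exists_restrictToCompl_eq_zero ℤ n h2 (e ⟨j, hjlt⟩)
  obtain ⟨D, hD, hDne, w, hw⟩ := exists_restrictToCompl_eq_nsmul_of_gradedBasis ℤ hY hP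
    (LerayHirsch.evenDeg (n + 1 + 1)) e he (k := k) 0 hyp z
  exact ⟨D, hD, hDne, by rw [← zero_nsmul w]; exact hw⟩

/-- **Registered sub-goal `stub_hodgeClassesGenericallyDivisible_tensorProjectiveSpace` of the crux
item stmt-HodgeConjecture-18466** — the item's statement for the `2p`-folds `X = Y ⊗ ℙⁿ_ℂ`, `n ≥ 1`
(`Y` smooth projective of dimension `2p - n`), with NO Hodge-type hypothesis: for every
`z ∈ H²ᵖ(X(ℂ); ℤ)` and `m ≥ 1` there are a proper Zariski-closed `Z` and `y` (namely `0`) with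
`m • y = z|_{(X∖Z)(ℂ)}` (`genericDivisibility_tensorProjectiveSpace_restrict_eq_zero`).
[cite: HatcherAT2002, §3.2 Thm. 3.16 and Thm. 3.19] [cite: AndreottiFrankel1959, Thm. 1]
[cite: SerreGAGA1956, §2 n°5] -/
theorem stub_hodgeClassesGenericallyDivisible_tensorProjectiveSpace :
    ∀ ⦃p n : ℕ⦄ ⦃Y : SchemeOver ℂ⦄, 1 ≤ p → 1 ≤ n → IsSmoothProjective (2 * p - n) Y →
      ∀ z : singularCohomology ℤ ℤ
        (ComplexPoints (CategoryTheory.MonoidalCategoryStruct.tensorObj Y (projectiveSpace n ℂ)))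
        (2 * p),
        ∀ m : ℕ, 1 ≤ m →
          ∃ Z : Set (CategoryTheory.MonoidalCategoryStruct.tensorObj Y (projectiveSpace n ℂ)).left,
            IsClosed Z ∧ Z ≠ Set.univ ∧
            ∃ y : singularCohomology ℤ ℤ
              (complexPointsCompl
                (CategoryTheory.MonoidalCategoryStruct.tensorObj Y (projectiveSpace n ℂ)) Z) (2 * p),
              m • y = singularCohomology.map ℤ ℤ
                (⟨Subtype.val, continuous_subtype_val⟩ :
                  C(complexPointsCompl
                      (CategoryTheory.MonoidalCategoryStruct.tensorObj Y (projectiveSpace n ℂ)) Z,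
                    ComplexPoints
                      (CategoryTheory.MonoidalCategoryStruct.tensorObj Y (projectiveSpace n ℂ))))
                (2 * p) z := by
  intro p n Y hp hn hY z m _
  obtain ⟨n, rfl⟩ : ∃ n', n = n' + 1 := ⟨n - 1, by omega⟩
  obtain ⟨Z, hZ, hZne, h0⟩ := genericDivisibility_tensorProjectiveSpace_restrict_eq_zero hY n
    (show 2 * p - (n + 1) < 2 * p by omega) z
  exact ⟨Z, hZ, hZne, 0, by rw [nsmul_zero]; exact h0.symm⟩

end Summit.HodgeConjecture.HodgeConjecture.Theorems

end
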